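import Summits.Ventures.PercRepro.S1ChainSkewHull

/-!
# PercRepro — THE TRACE OF A CIRCUIT THROUGH AN OUTSIDE POINT ON THE PRINCIPAL CLOSED TRACE (p2, gen 24; SUBCLAIM-S1 §6.9 (vii) step 4, part 1)

For a point `z ∉ U` in the closure of a skew union `U = ⋃𝒯` of triangles, with principal closed trace `F`
(S1ChainSkewFilter), the shape lemma (S1ChainSkewHull) describes the trace `B = C ∖ {z}` of every circuit `C ∋ z`
with `C ⊆ U ∪ {z}`: on a triangle inside `F` it has exactly two points, on a triangle meeting `F` in one point `a` it
is `{a}` or the other two points, and it misses the triangles missing `F`. With `|B| = Σ_T |B ∩ T|` this pins down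
the four-circuits through `z`: writing `ℓ` for the number of triangles inside `F` and `q` for the number meeting it in
one point, `|B| = 3` forces `(ℓ, q) ∈ {(1, 1), (0, 3), (0, 2)}`, with `3`, `1`, `2` possible traces. This module
proves the first half: `|B| = Σ_T |B ∩ T|`, the trichotomy of a trace, THE TRACE `B ∩ F` DETERMINES `B`, and
`|B ∩ F| ∈ {3, 1}` (with no triangle inside `F` in the second case); S1ChainSkewCap finishes the count.

* `ncard_eq_sum_inter_of_skew_union` — `|B| = Σ_T |B ∩ T|` for `B ⊆ U`;
* `ncard_inter_eq_two_of_subset_principal` — exactly two points on a triangle inside `F`;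
* `trace_cases` — the trichotomy of a trace; `eq_of_inter_principal_eq` — the trace on `F` determines the circuit;
* `ncard_inter_principal_cases` — the trace on `F` has three points or one (the cap itself is S1ChainSkewCap).
Axioms: standard.
-/

open scoped Matroid

namespace PercRepro

namespace S1

open Set

variable {α : Type}

/-- `|B| = Σ_T |B ∩ T|` for `B` inside a skew union (the triangles are pairwise disjoint). -/
theorem ncard_eq_sum_inter_of_skew_union (M : Matroid α) [M.Finite] (𝒯 : Finset (Set α))
    (h𝒯 : ∀ C ∈ 𝒯, M.IsCircuit C ∧ C.ncard = 3) (hskew : M.eRk (⋃ C ∈ 𝒯, C) = 2 * 𝒯.card)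
    {B : Set α} (hB : B ⊆ ⋃ C ∈ 𝒯, C) : B.ncard = ∑ T ∈ 𝒯, (B ∩ T).ncard := by
  classical
  have hdisj : ∀ {T T' : Set α}, T ∈ 𝒯 → T' ∈ 𝒯 → T ≠ T' → Disjoint T T' :=
    fun hT hT' hne => disjoint_of_skew_union M 𝒯 h𝒯 hskew hT hT' hne
  have hUfin : (⋃ C ∈ 𝒯, C).Finite := M.ground_finite.subset (biUnion_subset_ground M 𝒯 h𝒯)
  have hBfin : B.Finite := hUfin.subset hB
  -- induction on the family, with the disjointness carried along
  suffices h : ∀ (𝒮 : Finset (Set α)), 𝒮 ⊆ 𝒯 → ∀ B' ⊆ ⋃ C ∈ 𝒮, C, B'.ncard = ∑ T ∈ 𝒮, (B' ∩ T).ncard from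
    h 𝒯 (Finset.Subset.refl _) B hB
  intro 𝒮
  induction 𝒮 using Finset.induction_on with
  | empty =>
    intro _ B' hB'
    simp only [Finset.notMem_empty, Set.iUnion_of_empty, Set.iUnion_empty, Set.subset_empty_iff] at hB'
    rw [hB', Set.ncard_empty, Finset.sum_empty]
  | insert T 𝒮' hT ih =>
    intro h𝒮 B' hB'
    rw [Finset.set_biUnion_insert] at hB'
    have hT𝒯 : T ∈ 𝒯 := h𝒮 (Finset.mem_insert_self T 𝒮')
    have h𝒮' : 𝒮' ⊆ 𝒯 := fun C hC => h𝒮 (Finset.mem_insert_of_mem hC)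
    have hsplit : B' = (B' ∩ T) ∪ (B' ∩ ⋃ C ∈ 𝒮', C) := by
      ext x; simp only [Set.mem_union, Set.mem_inter_iff]; constructor
      · intro hx
        rcases hB' hx with h | h
        · exact Or.inl ⟨hx, h⟩
        · exact Or.inr ⟨hx, h⟩
      · rintro (⟨h, _⟩ | ⟨h, _⟩) <;> exact h
    have hd : Disjoint (B' ∩ T) (B' ∩ ⋃ C ∈ 𝒮', C) := by
      rw [Set.disjoint_left]
      rintro x ⟨-, hxT⟩ ⟨-, hxU⟩
      obtain ⟨C, hC, hxC⟩ := Set.mem_iUnion₂.1 hxU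
      have hne : C ≠ T := fun h => hT (h ▸ hC)
      exact Set.disjoint_left.1 (hdisj (h𝒮' hC) hT𝒯 hne) hxC hxT
    have hB'fin : B'.Finite := (hUfin.subset (hB'.trans (Set.union_subset
      (fun x hx => Set.mem_iUnion₂.2 ⟨T, hT𝒯, hx⟩)
      (fun x hx => by
        obtain ⟨C, hC, hxC⟩ := Set.mem_iUnion₂.1 hx
        exact Set.mem_iUnion₂.2 ⟨C, h𝒮' hC, hxC⟩))))
    rw [Finset.sum_insert hT]
    conv_lhs => rw [hsplit]
    rw [Set.ncard_union_eq hd (hB'fin.subset Set.inter_subset_left) (hB'fin.subset Set.inter_subset_left)]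
    congr 1
    rw [ih h𝒮' (B' ∩ ⋃ C ∈ 𝒮', C) Set.inter_subset_right]
    refine Finset.sum_congr rfl (fun C hC => ?_)
    congr 1
    ext x; simp only [Set.mem_inter_iff, Set.mem_iUnion, exists_prop]
    constructor
    · rintro ⟨⟨hxB, -⟩, hxC⟩; exact ⟨hxB, hxC⟩
    · rintro ⟨hxB, hxC⟩; exact ⟨⟨hxB, C, hC, hxC⟩, hxC⟩

/-- On a triangle inside the principal trace, the trace of a circuit through `z` has EXACTLY two points
(three would make one of them removable). -/
theorem ncard_inter_eq_two_of_subset_principal (M : Matroid α) [M.Finite] (𝒯 : Finset (Set α))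
    (h𝒯 : ∀ C ∈ 𝒯, M.IsCircuit C ∧ C.ncard = 3) (hskew : M.eRk (⋃ C ∈ 𝒯, C) = 2 * 𝒯.card)
    {z : α} (hzU : z ∉ ⋃ C ∈ 𝒯, C) {F : Set α} (hFU : F ⊆ ⋃ C ∈ 𝒯, C) (hzF : z ∈ M.closure F)
    (hFmin : ∀ A ⊆ ⋃ C ∈ 𝒯, C, (∀ T ∈ 𝒯, (A ∩ T).ncard ≤ 1 ∨ T ⊆ A) → z ∈ M.closure A → F ⊆ A)
    {B : Set α} (hB : B ⊆ ⋃ C ∈ 𝒯, C) (hC : M.IsCircuit (insert z B)) {T : Set α} (hT : T ∈ 𝒯)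
    (hTF : T ⊆ F) : (B ∩ T).ncard = 2 := by
  have hTfin : T.Finite := M.ground_finite.subset (h𝒯 T hT).1.subset_ground
  have h2 := (shape_of_isCircuit_of_principal M 𝒯 h𝒯 hskew hzU hFU hzF hFmin hB hC hT).2.1 hTF
  have hle : (B ∩ T).ncard ≤ 3 := by
    have := Set.ncard_le_ncard (Set.inter_subset_right : B ∩ T ⊆ T) hTfin
    rwa [(h𝒯 T hT).2] at this
  by_contra hne
  have h3 : (B ∩ T).ncard = 3 := by omega
  have hTB : T ⊆ B := by
    have : B ∩ T = T := Set.eq_of_subset_of_ncard_le Set.inter_subset_right (by rw [h3, (h𝒯 T hT).2]) hTfin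
    exact fun x hx => ((Set.ext_iff.1 this x).2 hx).1
  -- remove a point `x ∈ T`: the other two points still carry `T` into the hull
  have hzB : z ∉ B := fun h => hzU (hB h)
  obtain ⟨x, hxT⟩ : T.Nonempty := by
    rw [Set.nonempty_iff_ne_empty]
    intro h
    have h3' := (h𝒯 T hT).2
    rw [h, Set.ncard_empty] at h3'
    omega
  have hss : B \ {x} ⊂ B := Set.sdiff_singleton_ssubset.2 (hTB hxT)
  have hncl := notMem_closure_of_ssubset_of_isCircuit M hC hzB hss
  apply hncl
  rw [mem_closure_iff_principal_subset_skewHull M 𝒯 h𝒯 hskew hzF hFmin (Set.sdiff_subset.trans hB)]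
  have hFh : F ⊆ B ∪ ⋃ T ∈ 𝒯.filter (fun T => 2 ≤ (B ∩ T).ncard), T :=
    (mem_closure_iff_principal_subset_skewHull M 𝒯 h𝒯 hskew hzF hFmin hB).1 (by
      have hdep : M.Dep (insert z B) := hC.dep
      have hI : M.Indep B := hC.ssubset_indep (Set.ssubset_insert hzB)
      exact (hI.mem_closure_iff_of_notMem hzB).2 hdep)
  intro y hyF
  by_cases hyT : y ∈ T
  · -- `y ∈ T`: `T` is in the hull of `B ∖ {x}` since two of its points remain
    rw [mem_skewHull_iff]
    right
    refine ⟨T, hT, hyT, ?_⟩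
    have e : (B \ {x}) ∩ T = T \ {x} := by
      ext w; simp only [Set.mem_inter_iff, Set.mem_sdiff, Set.mem_singleton_iff]
      constructor
      · rintro ⟨⟨-, hw⟩, hwT⟩; exact ⟨hwT, hw⟩
      · rintro ⟨hwT, hw⟩; exact ⟨⟨hTB hwT, hw⟩, hwT⟩
    rw [e, Set.ncard_sdiff_singleton_of_mem hxT, (h𝒯 T hT).2]
  · obtain ⟨T', hT', hyT'⟩ := Set.mem_iUnion₂.1 (hFU hyF)
    have hne : T' ≠ T := fun h => hyT (h ▸ hyT')
    exact (mem_skewHull_diff_iff M 𝒯 h𝒯 hskew hT hT' hne hxT hyT').2 (hFh hyF)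

/-- **THE TRICHOTOMY OF A TRACE**: on every triangle `T`, the trace of a circuit `{z} ∪ B` is empty with `F ∩ T = ∅`,
or `T ⊆ F` with exactly two points, or `F ∩ T = {a}` with `B ∩ T = {a}` or the other two points of `T`. -/
theorem trace_cases (M : Matroid α) [M.Finite] (𝒯 : Finset (Set α))
    (h𝒯 : ∀ C ∈ 𝒯, M.IsCircuit C ∧ C.ncard = 3) (hskew : M.eRk (⋃ C ∈ 𝒯, C) = 2 * 𝒯.card)
    {z : α} (hzU : z ∉ ⋃ C ∈ 𝒯, C) {F : Set α} (hFU : F ⊆ ⋃ C ∈ 𝒯, C)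
    (hFcl : ∀ T ∈ 𝒯, (F ∩ T).ncard ≤ 1 ∨ T ⊆ F) (hzF : z ∈ M.closure F)
    (hFmin : ∀ A ⊆ ⋃ C ∈ 𝒯, C, (∀ T ∈ 𝒯, (A ∩ T).ncard ≤ 1 ∨ T ⊆ A) → z ∈ M.closure A → F ⊆ A)
    {B : Set α} (hB : B ⊆ ⋃ C ∈ 𝒯, C) (hC : M.IsCircuit (insert z B)) {T : Set α} (hT : T ∈ 𝒯) :
    (B ∩ T = ∅ ∧ F ∩ T = ∅) ∨ (T ⊆ F ∧ (B ∩ T).ncard = 2) ∨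
      (∃ a, F ∩ T = {a} ∧ (B ∩ T = {a} ∨ ((B ∩ T).ncard = 2 ∧ a ∉ B))) := by
  have hTfin : T.Finite := M.ground_finite.subset (h𝒯 T hT).1.subset_ground
  obtain ⟨hsh1, -, hsh3⟩ := shape_of_isCircuit_of_principal M 𝒯 h𝒯 hskew hzU hFU hzF hFmin hB hC hT
  rcases hFcl T hT with h1 | hTF
  · rcases Nat.eq_zero_or_pos (F ∩ T).ncard with h0 | hpos
    · left
      have hFT : F ∩ T = ∅ := (Set.ncard_eq_zero (hTfin.subset Set.inter_subset_right)).1 h0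
      refine ⟨?_, hFT⟩
      by_contra hne
      have := hsh1 (Set.nonempty_iff_ne_empty.2 hne)
      rw [hFT] at this
      exact Set.not_nonempty_empty this
    · right; right
      have h1' : (F ∩ T).ncard = 1 := by omega
      obtain ⟨a, ha⟩ := Set.ncard_eq_one.1 h1'
      exact ⟨a, ha, hsh3 a ha⟩
  · right; left
    exact ⟨hTF, ncard_inter_eq_two_of_subset_principal M 𝒯 h𝒯 hskew hzU hFU hzF hFmin hB hC hT hTF⟩

/-- **`B ∩ F` DETERMINES `B`**: two circuits through `z` with the same trace on `F` have the same trace on every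
triangle, hence coincide. -/
theorem eq_of_inter_principal_eq (M : Matroid α) [M.Finite] (𝒯 : Finset (Set α))
    (h𝒯 : ∀ C ∈ 𝒯, M.IsCircuit C ∧ C.ncard = 3) (hskew : M.eRk (⋃ C ∈ 𝒯, C) = 2 * 𝒯.card)
    {z : α} (hzU : z ∉ ⋃ C ∈ 𝒯, C) {F : Set α} (hFU : F ⊆ ⋃ C ∈ 𝒯, C)
    (hFcl : ∀ T ∈ 𝒯, (F ∩ T).ncard ≤ 1 ∨ T ⊆ F) (hzF : z ∈ M.closure F)
    (hFmin : ∀ A ⊆ ⋃ C ∈ 𝒯, C, (∀ T ∈ 𝒯, (A ∩ T).ncard ≤ 1 ∨ T ⊆ A) → z ∈ M.closure A → F ⊆ A)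
    {B B' : Set α} (hB : B ⊆ ⋃ C ∈ 𝒯, C) (hC : M.IsCircuit (insert z B)) (hB' : B' ⊆ ⋃ C ∈ 𝒯, C)
    (hC' : M.IsCircuit (insert z B')) (heq : B ∩ F = B' ∩ F) : B = B' := by
  -- the traces agree on every triangle
  have key : ∀ T ∈ 𝒯, B ∩ T = B' ∩ T := by
    intro T hT
    have hTfin : T.Finite := M.ground_finite.subset (h𝒯 T hT).1.subset_ground
    rcases trace_cases M 𝒯 h𝒯 hskew hzU hFU hFcl hzF hFmin hB hC hT with ⟨hBT, hFT⟩ | ⟨hTF, -⟩ | ⟨a, hFa, hBa⟩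
    · -- both empty
      rcases trace_cases M 𝒯 h𝒯 hskew hzU hFU hFcl hzF hFmin hB' hC' hT with ⟨hB'T, -⟩ | ⟨hTF, -⟩ | ⟨a, hFa, -⟩
      · rw [hBT, hB'T]
      · exfalso
        have : T ⊆ F ∩ T := fun x hx => ⟨hTF hx, hx⟩
        rw [hFT] at this
        have h3 := (h𝒯 T hT).2
        rw [Set.subset_empty_iff.1 this, Set.ncard_empty] at h3
        omega
      · exfalso
        have : a ∈ F ∩ T := by rw [hFa]; rfl
        rw [hFT] at this
        exact this
    · -- `T ⊆ F`: the traces lie in `F`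
      ext x
      constructor
      · rintro ⟨hxB, hxT⟩
        have : x ∈ B' ∩ F := heq ▸ ⟨hxB, hTF hxT⟩
        exact ⟨this.1, hxT⟩
      · rintro ⟨hxB', hxT⟩
        have : x ∈ B ∩ F := heq.symm ▸ ⟨hxB', hTF hxT⟩
        exact ⟨this.1, hxT⟩
    · -- `F ∩ T = {a}`
      have haT : a ∈ T := ((Set.ext_iff.1 hFa a).2 rfl).2
      have haF : a ∈ F := ((Set.ext_iff.1 hFa a).2 rfl).1
      rcases trace_cases M 𝒯 h𝒯 hskew hzU hFU hFcl hzF hFmin hB' hC' hT with ⟨-, hFT⟩ | ⟨hTF, -⟩ | ⟨a', hFa', hB'a⟩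
      · exfalso
        have : a ∈ F ∩ T := ⟨haF, haT⟩
        rw [hFT] at this
        exact this
      · exfalso
        have : T ⊆ F ∩ T := fun x hx => ⟨hTF hx, hx⟩
        rw [hFa] at this
        have h3 := (h𝒯 T hT).2
        have := Set.ncard_le_ncard this (Set.finite_singleton a)
        rw [Set.ncard_singleton] at this
        omega
      · have haa' : a' = a := by
          have : a' ∈ F ∩ T := by rw [hFa']; rfl
          rw [hFa] at this
          exact this
        rw [haa'] at hB'a
        -- `a ∈ B ↔ a ∈ B'`
        have hiff : a ∈ B ↔ a ∈ B' := by
          constructor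
          · intro h; exact (heq ▸ (⟨h, haF⟩ : a ∈ B ∩ F) : a ∈ B' ∩ F).1
          · intro h; exact (heq.symm ▸ (⟨h, haF⟩ : a ∈ B' ∩ F) : a ∈ B ∩ F).1
        -- a two-point trace avoiding `a` is `T ∖ {a}`
        have htwo : ∀ {X : Set α}, X ⊆ ⋃ C ∈ 𝒯, C → (X ∩ T).ncard = 2 → a ∉ X → X ∩ T = T \ {a} := by
          intro X _ h2 haX
          have hsub : X ∩ T ⊆ T \ {a} := fun x hx => ⟨hx.2, fun h => haX (Set.mem_singleton_iff.1 h ▸ hx.1)⟩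
          have hcard : (T \ {a}).ncard = 2 := by
            rw [Set.ncard_sdiff_singleton_of_mem haT, (h𝒯 T hT).2]
          exact Set.eq_of_subset_of_ncard_le hsub (by rw [h2, hcard]) (hTfin.subset Set.sdiff_subset)
        rcases hBa with hBa | ⟨hB2, haB⟩ <;> rcases hB'a with hB'a | ⟨hB'2, haB'⟩
        · rw [hBa, hB'a]
        · exfalso
          have : a ∈ B := ((Set.ext_iff.1 hBa a).2 rfl).1
          exact haB' (hiff.1 this)
        · exfalso
          have : a ∈ B' := ((Set.ext_iff.1 hB'a a).2 rfl).1
          exact haB (hiff.2 this)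
        · rw [htwo hB hB2 haB, htwo hB' hB'2 haB']
  -- a subset of `U` is the union of its traces
  ext x
  constructor
  · intro hx
    obtain ⟨T, hT, hxT⟩ := Set.mem_iUnion₂.1 (hB hx)
    have : x ∈ B' ∩ T := key T hT ▸ ⟨hx, hxT⟩
    exact this.1
  · intro hx
    obtain ⟨T, hT, hxT⟩ := Set.mem_iUnion₂.1 (hB' hx)
    have : x ∈ B ∩ T := (key T hT).symm ▸ ⟨hx, hxT⟩
    exact this.1

/-- **THE TRACE ON `F` HAS THREE POINTS OR ONE**: for a circuit `{z} ∪ B` with `|B| = 3`, `B ∖ F` is empty or the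
two-point trace of `B` on a single triangle (`F ∩ T = {a}`, `a ∉ B`) — and in the latter case no triangle lies
inside `F`. -/
theorem ncard_inter_principal_cases (M : Matroid α) [M.Finite] (𝒯 : Finset (Set α))
    (h𝒯 : ∀ C ∈ 𝒯, M.IsCircuit C ∧ C.ncard = 3) (hskew : M.eRk (⋃ C ∈ 𝒯, C) = 2 * 𝒯.card)
    {z : α} (hzU : z ∉ ⋃ C ∈ 𝒯, C) {F : Set α} (hFU : F ⊆ ⋃ C ∈ 𝒯, C)
    (hFcl : ∀ T ∈ 𝒯, (F ∩ T).ncard ≤ 1 ∨ T ⊆ F) (hzF : z ∈ M.closure F)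
    (hFmin : ∀ A ⊆ ⋃ C ∈ 𝒯, C, (∀ T ∈ 𝒯, (A ∩ T).ncard ≤ 1 ∨ T ⊆ A) → z ∈ M.closure A → F ⊆ A)
    {B : Set α} (hB : B ⊆ ⋃ C ∈ 𝒯, C) (hC : M.IsCircuit (insert z B)) (hB3 : B.ncard = 3) :
    (B ∩ F).ncard = 3 ∨ ((B ∩ F).ncard = 1 ∧ ∀ T ∈ 𝒯, ¬ T ⊆ F) := by
  classical
  have hUfin : (⋃ C ∈ 𝒯, C).Finite := M.ground_finite.subset (biUnion_subset_ground M 𝒯 h𝒯)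
  have hBfin : B.Finite := hUfin.subset hB
  have hcases := fun T hT => trace_cases M 𝒯 h𝒯 hskew hzU hFU hFcl hzF hFmin hB hC (T := T) hT
  -- a point of `B ∖ F` lies on a triangle of the two-point-avoiding type
  have hoff : ∀ x ∈ B \ F, ∃ T ∈ 𝒯, x ∈ T ∧ (B ∩ T).ncard = 2 ∧ ∃ a, F ∩ T = {a} ∧ a ∉ B := by
    rintro x ⟨hxB, hxF⟩
    obtain ⟨T, hT, hxT⟩ := Set.mem_iUnion₂.1 (hB hxB)
    refine ⟨T, hT, hxT, ?_⟩
    rcases hcases T hT with ⟨hBT, -⟩ | ⟨hTF, -⟩ | ⟨a, hFa, hBa | ⟨h2, haB⟩⟩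
    · exfalso
      have : x ∈ B ∩ T := ⟨hxB, hxT⟩
      rw [hBT] at this
      exact this
    · exact absurd (hTF hxT) hxF
    · have : x ∈ B ∩ T := ⟨hxB, hxT⟩
      rw [hBa] at this
      exact absurd (((Set.ext_iff.1 hFa a).2 rfl).1) (Set.mem_singleton_iff.1 this ▸ hxF)
    · exact ⟨h2, a, hFa, haB⟩
  by_cases hempty : B \ F = ∅
  · left
    have : B ∩ F = B := by
      ext x; constructor
      · exact fun h => h.1
      · intro hx
        refine ⟨hx, ?_⟩
        by_contra hxF
        have : x ∈ B \ F := ⟨hx, hxF⟩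
        rw [hempty] at this
        exact this
    rw [this, hB3]
  · right
    obtain ⟨x, hx⟩ := Set.nonempty_iff_ne_empty.2 hempty
    obtain ⟨T₁, hT₁, hxT₁, h2, a₁, hFa₁, ha₁B⟩ := hoff x hx
    have hT₁fin : T₁.Finite := M.ground_finite.subset (h𝒯 T₁ hT₁).1.subset_ground
    -- `B ∖ F = B ∩ T₁`
    have hBT₁F : B ∩ T₁ ⊆ B \ F := by
      rintro y ⟨hyB, hyT₁⟩
      refine ⟨hyB, fun hyF => ?_⟩
      have : y ∈ F ∩ T₁ := ⟨hyF, hyT₁⟩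
      rw [hFa₁] at this
      exact ha₁B (Set.mem_singleton_iff.1 this ▸ hyB)
    have hdiff : B \ F = B ∩ T₁ := by
      apply Set.Subset.antisymm _ hBT₁F
      intro y hy
      obtain ⟨T₂, hT₂, hyT₂, h2', -⟩ := hoff y hy
      by_cases hTT : T₂ = T₁
      · exact ⟨hy.1, hTT ▸ hyT₂⟩
      · exfalso
        -- two such triangles carry four points of `B`
        have hd : Disjoint (B ∩ T₁) (B ∩ T₂) := by
          rw [Set.disjoint_left]
          rintro w ⟨-, hw1⟩ ⟨-, hw2⟩
          exact Set.disjoint_left.1 (disjoint_of_skew_union M 𝒯 h𝒯 hskew hT₂ hT₁ hTT) hw2 hw1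
        have := Set.ncard_le_ncard (Set.union_subset Set.inter_subset_left Set.inter_subset_left :
          (B ∩ T₁) ∪ (B ∩ T₂) ⊆ B) hBfin
        rw [Set.ncard_union_eq hd (hBfin.subset Set.inter_subset_left) (hBfin.subset Set.inter_subset_left), h2,
          h2', hB3] at this
        omega
    have hsum := Set.ncard_inter_add_ncard_sdiff_eq_ncard B F hBfin
    rw [hdiff, h2, hB3] at hsum
    refine ⟨by omega, fun T hT hTF => ?_⟩
    -- a triangle inside `F` would carry two more points of `B`
    have hne : T ≠ T₁ := by
      intro h
      rw [h] at hTF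
      have : a₁ ∈ T₁ := ((Set.ext_iff.1 hFa₁ a₁).2 rfl).2
      have hT₁F := hTF
      have h3 : (F ∩ T₁).ncard = 3 := by rw [Set.inter_eq_right.2 hT₁F, (h𝒯 T₁ hT₁).2]
      rw [hFa₁, Set.ncard_singleton] at h3
      omega
    have h2T := ncard_inter_eq_two_of_subset_principal M 𝒯 h𝒯 hskew hzU hFU hzF hFmin hB hC hT hTF
    have hd : Disjoint (B ∩ T₁) (B ∩ T) := by
      rw [Set.disjoint_left]
      rintro w ⟨-, hw1⟩ ⟨-, hw2⟩
      exact Set.disjoint_left.1 (disjoint_of_skew_union M 𝒯 h𝒯 hskew hT hT₁ hne) hw2 hw1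
    have := Set.ncard_le_ncard (Set.union_subset Set.inter_subset_left Set.inter_subset_left :
      (B ∩ T₁) ∪ (B ∩ T) ⊆ B) hBfin
    rw [Set.ncard_union_eq hd (hBfin.subset Set.inter_subset_left) (hBfin.subset Set.inter_subset_left), h2,
      h2T, hB3] at this
    omega

end S1

end PercRepro
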